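import Summits.QuantumFields.BalabanUV.Beta.GAN24.SecondOrderLipschitz

/-!
# `BalabanUV.Beta.GAN24.SecondOrderLipschitzBi` — THE SECOND-ORDER RESPONSE CARRIER IS LIPSCHITZ IN ITS ARGUMENTS, part 2:
# the slices, the bi-vertex and the mixed bi-vertex, in the FAR form (one coarse centre, constant decaying in the separation of the two
# coarse bonds) so that BOTH index orders follow by re-centring
# (G-an2-4 formalisation swarm, leaf prover 03, gen 16; generic engine toward the W-slot's CAUCHY binder `hWall` ∕ `hW₂all`)

NOT IN PRINT; OUR PROOF (elementary).  HONEST FRAMING (cell contract, verbatim): «discharging `BetaPertH` makes Bałaban's UV stability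
UNCONDITIONAL — a real constructive-QFT result; it is NOT the continuum limit and NOT the Clay problem.»  HONEST DEPENDENCY (verbatim):
«continuum YM on T⁴ ⇐ BetaPertH ∧ nine spine estimates (0/9 proved); BetaPertH ⇐ (D1) ∧ (D4) ∧ CAP+tail; G-an2-4 gates asym, D1 and
NE2/3/4.»

WHAT ([folklore]; continuation of `GAN24/SecondOrderLipschitz`).  For packed kernels `K, K′` (`Decays · C m`, deviation `Decays (K − K′) εK m`)
and second tables `S₂, S₂′` (`LocStencil₂ · C₂ m`, deviation `ε₂`), resp. `M₂, M₂′` (`LocStencilFM N · C₂ m`, deviation `ε₂`):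
* §1 SLICES: `biLoc_vertexOfK_slice_sub`, `biLoc_vertexOfM_slice_sub` — the inner chain-rule vertices of a slice of `S₂` ∕ `M₂` differ by a
  far-centred stencil with constant `(d+1)·((εK·C₂ + C·ε₂)·Zl(m/2))·e^{−(m/2)|u − N•y′|}` (an2's `biLoc_vertexOfK_slice` ∕ `biLoc_vertexOfM_slice` with
  one factor a deviation; bricks `BalabanCompositeJets.biLoc_wsum_far`, an2's `biLoc_cwsum_far`, telescoping `wsum_sub_wsum_bdd` ∕ `cwsum_sub_cwsum_bdd`).
* §2 THE BI-VERTEX AND THE MIXED BI-VERTEX, FAR FORM: `biLoc_vertex2OfK_sub_far`, `biLoc_mixOfK_sub_far` — the differences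
  `vertex2OfK K N S₂ μ y ν y′ − vertex2OfK K′ N S₂′ μ y ν y′` (resp. `mixOfK`) are bi-localised at `(N•y, N•y)` with constant
  `lBi · e^{−(m/8)|N•y − N•y′|}`, rate `m/8` (an2's `biLoc_wsum_self_far` on each telescoped term); hence BOTH index orders by
  `biLoc_recenter_right` ∕ `biLoc_recenter_left`: `vertexFamily₂_vertex2OfK_sub`, `vertexFamily₂_vertex2OfK_swap_sub`, `vertexFamily₂_mixOfK_sub`,
  `vertexFamily₂_mixOfK_swap_sub` (constant `lBi`, rate `m/8` — the shape of an2's `cBi`, LINEAR in `(εK, ε₂)`).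
Part 3 (`SecondOrderLipschitzResp`): the second-response piece; part 4 (`SecondOrderLipschitzW2`): `W2OfK`, `W2SymOfK`, the family (Cauchy) form.

HONEST: generic kernel algebra over an2's carriers; instantiates NO binder of the wall, asserts NO shape of Bałaban's tables («T2Shape» ∕
«T2Drift» stay located ∕ OPEN), discharges NOTHING of (hW, hWall); NOT «W-slot closed», NEVER «G-an2-4 closed»; NOT BetaPertH, NOT continuum,
NOT Clay.  0 sorry, 0 cite, 0 `def … : Prop`.
-/

noncomputable section

open Finset
open scoped BigOperators
open Literature.MathematicalPhysics.QuantumFieldTheory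
open Literature.MathematicalPhysics.QuantumFieldTheory.Balaban1983to89
open Literature.MathematicalPhysics.QuantumFieldTheory.Balaban1983to89.Beta
open B12Sec2to5 (l1 l1_nonneg)
open ExpKernelCalculus (MKer Decays BiLoc VertexFamily VertexFamily₂ Zl Zl_nonneg l1_sub_symm)
open OneStepResolventKernel (Fib LocStencil wsum bound_mono biLoc_mono)
open OneStepKernelFamily (colH abs_colH_le vertexOfK)
open InterLevelTransport (cwsum biLoc_cwsum)
open KernelWard (bdd_of_biLoc biLoc_add)
open HessKerRate (colH_sub biLoc_wsum_sub_wsum)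
open BalabanCompositeJets (LocStencil₂ biLoc_wsum_far)
open SecondOrderResponse (colM abs_colM_le vertexOfM dM vertex2OfK mixOfK LocStencilFM biLoc_cwsum_far biLoc_wsum_self_far
  biLoc_recenter_left biLoc_recenter_right abs_colH_le_of_biLoc abs_colM_le_of_biLoc biLoc_vertexOfK_slice biLoc_vertexOfM_slice)
open Summit.QuantumFields.BalabanUV.Beta.GAN24.SecondOrderLipschitz (wsum_sub_wsum_bdd cwsum_sub_cwsum_bdd mul_exp_neg_le abs_le_of_biLoc
  colM_sub ldM ldM_nonneg)

namespace Summit.QuantumFields.BalabanUV.Beta.GAN24.SecondOrderLipschitzBi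

variable {d : ℕ} {N : ℕ} [NeZero N]

/-! ## §1 The inner vertices of a slice are Lipschitz (far-centred form) -/

section Slices

omit [NeZero N] in
/-- [folklore] **THE INNER FIELD-COLUMN VERTEX OF A SLICE IS LIPSCHITZ IN `(K, S₂)`**: for `K, K′` decaying at rate `m` (constant `C`, deviation `εK`)
and local bi-stencil families `S₂, S₂′` at rate `m` (constant `C₂`, deviation `ε₂`), the difference `vertexOfK K N (S₂ κ u) ν y′ − vertexOfK K′ N (S₂′ κ u) ν y′`
is bi-localised at the first bond `u` with constant `(d+1)·((εK·C₂ + C·ε₂)·Zl(m/2))·e^{−(m/2)|u − N•y′|}` (an2's `biLoc_vertexOfK_slice` with one factor a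
deviation). -/
theorem biLoc_vertexOfK_slice_sub {K K' : MKer (d + 1) (Fib d)} {C εK m : ℝ} (hK : Decays K C m) (hK' : Decays K' C m)
    (hKK : Decays (K - K') εK m) (hm : 0 < m)
    {S₂ S₂' : Fin (d + 1) → (Fin (d + 1) → ℤ) → Fin (d + 1) → (Fin (d + 1) → ℤ) → MKer (d + 1) (Fib d)} {C₂ ε₂ : ℝ}
    (hS₂ : LocStencil₂ S₂ C₂ m) (hS₂' : LocStencil₂ S₂' C₂ m) (hSS₂ : LocStencil₂ (S₂ - S₂') ε₂ m)
    (κ : Fin (d + 1)) (u : Fin (d + 1) → ℤ) (ν : Fin (d + 1)) (y' : Fin (d + 1) → ℤ) :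
    BiLoc (vertexOfK K N (S₂ κ u) ν y' - vertexOfK K' N (S₂' κ u) ν y') u u
      ((d + 1 : ℕ) * ((εK * C₂ + C * ε₂) * Zl (d + 1) (m / 2) * Real.exp (-(m / 2) * l1 (u - (N : ℤ) • y')))) m := by
  have hC : 0 ≤ C := hK.nonneg (Sum.inl 0)
  have hεK : 0 ≤ εK := hKK.nonneg (Sum.inl 0)
  have hC₂ := hS₂.nonneg
  have hε₂ := hSS₂.nonneg
  have hw : ∀ (κ' : Fin (d + 1)) (u' : Fin (d + 1) → ℤ),
      |colH K N ν y' κ' u'| ≤ C * Real.exp (-m * l1 (u' - (N : ℤ) • y')) := fun κ' u' => abs_colH_le (N := N) hK ν y' κ' u'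
  have hw' : ∀ (κ' : Fin (d + 1)) (u' : Fin (d + 1) → ℤ),
      |colH K' N ν y' κ' u'| ≤ C * Real.exp (-m * l1 (u' - (N : ℤ) • y')) := fun κ' u' => abs_colH_le (N := N) hK' ν y' κ' u'
  have hww : ∀ (κ' : Fin (d + 1)) (u' : Fin (d + 1) → ℤ),
      |(colH K N ν y' κ' - colH K' N ν y' κ') u'| ≤ εK * Real.exp (-m * l1 (u' - (N : ℤ) • y')) := fun κ' u' => by
    rw [Pi.sub_apply, ← colH_sub]
    exact abs_colH_le (N := N) hKK ν y' κ' u'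
  have hb : ∀ (κ' : Fin (d + 1)) (u' x z : Fin (d + 1) → ℤ) (a b : Fib d), |S₂ κ u κ' u' x z a b| ≤ C₂ := fun κ' u' x z a b =>
    abs_le_of_biLoc (hS₂ κ u κ' u') hm.le (mul_exp_neg_le hC₂ hm.le (l1_nonneg _)) x z a b
  have hb' : ∀ (κ' : Fin (d + 1)) (u' x z : Fin (d + 1) → ℤ) (a b : Fib d), |S₂' κ u κ' u' x z a b| ≤ C₂ := fun κ' u' x z a b =>
    abs_le_of_biLoc (hS₂' κ u κ' u') hm.le (mul_exp_neg_le hC₂ hm.le (l1_nonneg _)) x z a b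
  have hterm : ∀ κ' : Fin (d + 1), BiLoc (wsum (colH K N ν y' κ') (S₂ κ u κ') - wsum (colH K' N ν y' κ') (S₂' κ u κ')) u u
      ((εK * C₂ + C * ε₂) * Zl (d + 1) (m / 2) * Real.exp (-(m / 2) * l1 (u - (N : ℤ) • y'))) m := by
    intro κ'
    rw [wsum_sub_wsum_bdd (hw κ') (hw' κ') hm (hb κ') (hb' κ')]
    have h1 := biLoc_wsum_far (hww κ') (fun u' => hS₂ κ u κ' u') hm hεK hC₂
    have h2 := biLoc_wsum_far (hw' κ') (fun u' => hSS₂ κ u κ' u') hm hC hε₂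
    have h := biLoc_add h1 h2
    intro x z a b
    refine (h x z a b).trans (le_of_eq ?_)
    ring
  have hsum := OneStepResolventKernel.biLoc_finset_sum (Finset.univ : Finset (Fin (d + 1))) (fun κ' _ => hterm κ')
  simp only [Finset.sum_const, Finset.card_univ, Fintype.card_fin, nsmul_eq_mul] at hsum
  intro x z a b
  have h := hsum x z a b
  simpa only [vertexOfK, Pi.sub_apply, Finset.sum_sub_distrib] using h

/-- [folklore] **THE INNER MULTIPLIER-COLUMN VERTEX OF A MIXED SLICE IS LIPSCHITZ IN `(K, M₂)`**: same shape, for local field–multiplier tables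
`M₂, M₂′` (`LocStencilFM`, constant `C₂`, deviation `ε₂`) — an2's `biLoc_vertexOfM_slice` with one factor a deviation (`biLoc_cwsum_far`). -/
theorem biLoc_vertexOfM_slice_sub {K K' : MKer (d + 1) (Fib d)} {C εK m : ℝ} (hK : Decays K C m) (hK' : Decays K' C m)
    (hKK : Decays (K - K') εK m) (hm : 0 < m)
    {M₂ M₂' : Fin (d + 1) → (Fin (d + 1) → ℤ) → Fin (d + 1) → (Fin (d + 1) → ℤ) → MKer (d + 1) (Fib d)} {C₂ ε₂ : ℝ}
    (hM₂ : LocStencilFM N M₂ C₂ m) (hM₂' : LocStencilFM N M₂' C₂ m) (hMM₂ : LocStencilFM N (M₂ - M₂') ε₂ m)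
    (κ : Fin (d + 1)) (u : Fin (d + 1) → ℤ) (ν : Fin (d + 1)) (y' : Fin (d + 1) → ℤ) :
    BiLoc (vertexOfM K N (M₂ κ u) ν y' - vertexOfM K' N (M₂' κ u) ν y') u u
      ((d + 1 : ℕ) * ((εK * C₂ + C * ε₂) * Zl (d + 1) (m / 2) * Real.exp (-(m / 2) * l1 (u - (N : ℤ) • y')))) m := by
  have hC : 0 ≤ C := hK.nonneg (Sum.inl 0)
  have hεK : 0 ≤ εK := hKK.nonneg (Sum.inl 0)
  have hC₂ := hM₂.nonneg
  have hε₂ := hMM₂.nonneg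
  have hQ : ∀ (ρ : Fin (d + 1)) (w : Fin (d + 1) → ℤ),
      BiLoc (M₂ κ u ρ w) u u (C₂ * Real.exp (-m * l1 ((N : ℤ) • w - u))) m := by
    intro ρ w
    have h := hM₂ κ u ρ w
    rwa [l1_sub_symm] at h
  have hQQ : ∀ (ρ : Fin (d + 1)) (w : Fin (d + 1) → ℤ),
      BiLoc ((M₂ κ u ρ - M₂' κ u ρ) w) u u (ε₂ * Real.exp (-m * l1 ((N : ℤ) • w - u))) m := by
    intro ρ w
    have h := hMM₂ κ u ρ w
    rw [l1_sub_symm] at h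
    exact h
  have hw : ∀ (ρ : Fin (d + 1)) (w : Fin (d + 1) → ℤ),
      |colM K N ν y' ρ w| ≤ C * Real.exp (-m * l1 ((N : ℤ) • w - (N : ℤ) • y')) := fun ρ w => abs_colM_le (N := N) hK ν y' ρ w
  have hw' : ∀ (ρ : Fin (d + 1)) (w : Fin (d + 1) → ℤ),
      |colM K' N ν y' ρ w| ≤ C * Real.exp (-m * l1 ((N : ℤ) • w - (N : ℤ) • y')) := fun ρ w => abs_colM_le (N := N) hK' ν y' ρ w
  have hww : ∀ (ρ : Fin (d + 1)) (w : Fin (d + 1) → ℤ),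
      |(colM K N ν y' ρ - colM K' N ν y' ρ) w| ≤ εK * Real.exp (-m * l1 ((N : ℤ) • w - (N : ℤ) • y')) := fun ρ w => by
    rw [Pi.sub_apply, ← colM_sub]
    exact abs_colM_le (N := N) hKK ν y' ρ w
  have hb : ∀ (ρ : Fin (d + 1)) (w x z : Fin (d + 1) → ℤ) (a b : Fib d), |M₂ κ u ρ w x z a b| ≤ C₂ := fun ρ w x z a b =>
    abs_le_of_biLoc (hM₂ κ u ρ w) hm.le (mul_exp_neg_le hC₂ hm.le (l1_nonneg _)) x z a b
  have hb' : ∀ (ρ : Fin (d + 1)) (w x z : Fin (d + 1) → ℤ) (a b : Fib d), |M₂' κ u ρ w x z a b| ≤ C₂ := fun ρ w x z a b =>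
    abs_le_of_biLoc (hM₂' κ u ρ w) hm.le (mul_exp_neg_le hC₂ hm.le (l1_nonneg _)) x z a b
  have hterm : ∀ ρ : Fin (d + 1), BiLoc (cwsum N (colM K N ν y' ρ) (M₂ κ u ρ) - cwsum N (colM K' N ν y' ρ) (M₂' κ u ρ)) u u
      ((εK * C₂ + C * ε₂) * Zl (d + 1) (m / 2) * Real.exp (-(m / 2) * l1 (u - (N : ℤ) • y'))) m := by
    intro ρ
    rw [cwsum_sub_cwsum_bdd (hw ρ) (hw' ρ) hm hC hC (hb ρ) (hb' ρ) hC₂ hC₂]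
    have h1 := biLoc_cwsum_far (hww ρ) (fun w => hQ ρ w) hm hεK hC₂
    have h2 := biLoc_cwsum_far (hw' ρ) (fun w => hQQ ρ w) hm hC hε₂
    have h := biLoc_add h1 h2
    intro x z a b
    refine (h x z a b).trans (le_of_eq ?_)
    ring
  have hsum := OneStepResolventKernel.biLoc_finset_sum (Finset.univ : Finset (Fin (d + 1))) (fun ρ _ => hterm ρ)
  simp only [Finset.sum_const, Finset.card_univ, Fintype.card_fin, nsmul_eq_mul] at hsum
  intro x z a b
  have h := hsum x z a b
  simpa only [vertexOfM, Pi.sub_apply, Finset.sum_sub_distrib] using h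

end Slices

/-! ## §2 The bi-vertex and the mixed bi-vertex are Lipschitz (far form ⟹ both index orders) -/

section BiVertex

/-- [folklore] The Lipschitz constant of the bi-vertex localisations (rate `m` in, `m/8` out): the outer weights' deviation against the inner
slices' constant `(d+1)·C·C₂·Zl(m/2)` plus the outer weights against the inner slices' deviation; LINEAR in `(εK, ε₂)` (an2's `cBi` with one factor a
deviation in each monomial). -/
def lBi (d : ℕ) (C C₂ εK ε₂ m : ℝ) : ℝ :=
  (d + 1 : ℕ) * ((εK * ((d + 1 : ℕ) * (C * C₂ * Zl (d + 1) (m / 2)))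
    + C * ((d + 1 : ℕ) * ((εK * C₂ + C * ε₂) * Zl (d + 1) (m / 2)))) * Zl (d + 1) (m / 8))

omit [NeZero N] in
/-- [folklore] `lBi` is nonnegative for nonnegative inputs. -/
theorem lBi_nonneg {C C₂ εK ε₂ m : ℝ} (hC : 0 ≤ C) (hC₂ : 0 ≤ C₂) (hεK : 0 ≤ εK) (hε₂ : 0 ≤ ε₂) (hm : 0 < m) :
    0 ≤ lBi d C C₂ εK ε₂ m := by
  unfold lBi
  have h2 := Zl_nonneg (D := d + 1) (half_pos hm)
  have h8 := Zl_nonneg (D := d + 1) (show 0 < m / 8 by positivity)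
  positivity

omit [NeZero N] in
/-- [folklore] **THE BI-VERTEX IS LIPSCHITZ IN `(K, S₂)`, FAR FORM**: the difference `vertex2OfK K N S₂ μ y ν y′ − vertex2OfK K′ N S₂′ μ y ν y′` is
bi-localised at `(N•y, N•y)` with constant `lBi d C C₂ εK ε₂ m · e^{−(m/8)|N•y − N•y′|}`, rate `m/8` (outer weights `colH K N μ y` from `N•y`, inner
slices self-localised with constants decaying from `N•y′`: an2's `biLoc_wsum_self_far` on each telescoped term). -/
theorem biLoc_vertex2OfK_sub_far {K K' : MKer (d + 1) (Fib d)} {C εK m : ℝ} (hK : Decays K C m) (hK' : Decays K' C m)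
    (hKK : Decays (K - K') εK m) (hm : 0 < m)
    {S₂ S₂' : Fin (d + 1) → (Fin (d + 1) → ℤ) → Fin (d + 1) → (Fin (d + 1) → ℤ) → MKer (d + 1) (Fib d)} {C₂ ε₂ : ℝ}
    (hS₂ : LocStencil₂ S₂ C₂ m) (hS₂' : LocStencil₂ S₂' C₂ m) (hSS₂ : LocStencil₂ (S₂ - S₂') ε₂ m)
    (μ : Fin (d + 1)) (y : Fin (d + 1) → ℤ) (ν : Fin (d + 1)) (y' : Fin (d + 1) → ℤ) :
    BiLoc (vertex2OfK K N S₂ μ y ν y' - vertex2OfK K' N S₂' μ y ν y') ((N : ℤ) • y) ((N : ℤ) • y)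
      (lBi d C C₂ εK ε₂ m * Real.exp (-(m / 8) * l1 ((N : ℤ) • y - (N : ℤ) • y'))) (m / 8) := by
  have hC : 0 ≤ C := hK.nonneg (Sum.inl 0)
  have hεK : 0 ≤ εK := hKK.nonneg (Sum.inl 0)
  have hC₂ := hS₂.nonneg
  have hε₂ := hSS₂.nonneg
  have hm2 : 0 < m / 2 := half_pos hm
  have hZ2 := Zl_nonneg (D := d + 1) hm2
  have hK₁ : 0 ≤ (d + 1 : ℕ) * (C * C₂ * Zl (d + 1) (m / 2)) := by positivity
  have hE₁ : 0 ≤ (d + 1 : ℕ) * ((εK * C₂ + C * ε₂) * Zl (d + 1) (m / 2)) := by positivity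
  -- inner slices, rate weakened `m → m/2`
  have hin : ∀ (κ : Fin (d + 1)) (u : Fin (d + 1) → ℤ), BiLoc (vertexOfK K N (S₂ κ u) ν y') u u
      ((d + 1 : ℕ) * (C * C₂ * Zl (d + 1) (m / 2)) * Real.exp (-(m / 2) * l1 (u - (N : ℤ) • y'))) (m / 2) := by
    intro κ u
    have h := biLoc_vertexOfK_slice (N := N) hK hC hS₂ hm κ u ν y'
    rw [← mul_assoc] at h
    exact biLoc_mono h (by positivity) (by linarith)
  have hin' : ∀ (κ : Fin (d + 1)) (u : Fin (d + 1) → ℤ), BiLoc (vertexOfK K' N (S₂' κ u) ν y') u u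
      ((d + 1 : ℕ) * (C * C₂ * Zl (d + 1) (m / 2)) * Real.exp (-(m / 2) * l1 (u - (N : ℤ) • y'))) (m / 2) := by
    intro κ u
    have h := biLoc_vertexOfK_slice (N := N) hK' hC hS₂' hm κ u ν y'
    rw [← mul_assoc] at h
    exact biLoc_mono h (by positivity) (by linarith)
  have hdin : ∀ (κ : Fin (d + 1)) (u : Fin (d + 1) → ℤ), BiLoc (vertexOfK K N (S₂ κ u) ν y' - vertexOfK K' N (S₂' κ u) ν y') u u
      ((d + 1 : ℕ) * ((εK * C₂ + C * ε₂) * Zl (d + 1) (m / 2)) * Real.exp (-(m / 2) * l1 (u - (N : ℤ) • y'))) (m / 2) := by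
    intro κ u
    have h := biLoc_vertexOfK_slice_sub (N := N) hK hK' hKK hm hS₂ hS₂' hSS₂ κ u ν y'
    rw [← mul_assoc] at h
    exact biLoc_mono h (by positivity) (by linarith)
  -- outer weights at rate `m/2`
  have hw : ∀ (κ : Fin (d + 1)) (u : Fin (d + 1) → ℤ),
      |colH K N μ y κ u| ≤ C * Real.exp (-(m / 2) * l1 (u - (N : ℤ) • y)) :=
    fun κ u => bound_mono (abs_colH_le (N := N) hK μ y κ u) hC le_rfl (by linarith) (l1_nonneg _)
  have hw' : ∀ (κ : Fin (d + 1)) (u : Fin (d + 1) → ℤ),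
      |colH K' N μ y κ u| ≤ C * Real.exp (-(m / 2) * l1 (u - (N : ℤ) • y)) :=
    fun κ u => bound_mono (abs_colH_le (N := N) hK' μ y κ u) hC le_rfl (by linarith) (l1_nonneg _)
  have hww : ∀ (κ : Fin (d + 1)) (u : Fin (d + 1) → ℤ),
      |(colH K N μ y κ - colH K' N μ y κ) u| ≤ εK * Real.exp (-(m / 2) * l1 (u - (N : ℤ) • y)) := fun κ u => by
    rw [Pi.sub_apply, ← colH_sub]
    exact bound_mono (abs_colH_le (N := N) hKK μ y κ u) hεK le_rfl (by linarith) (l1_nonneg _)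
  -- entrywise bounds of the inner slices (for the telescoping identity)
  have hb : ∀ (κ : Fin (d + 1)) (u x z : Fin (d + 1) → ℤ) (a b : Fib d),
      |vertexOfK K N (S₂ κ u) ν y' x z a b| ≤ (d + 1 : ℕ) * (C * C₂ * Zl (d + 1) (m / 2)) := fun κ u x z a b =>
    abs_le_of_biLoc (hin κ u) hm2.le (mul_exp_neg_le hK₁ hm2.le (l1_nonneg _)) x z a b
  have hb' : ∀ (κ : Fin (d + 1)) (u x z : Fin (d + 1) → ℤ) (a b : Fib d),
      |vertexOfK K' N (S₂' κ u) ν y' x z a b| ≤ (d + 1 : ℕ) * (C * C₂ * Zl (d + 1) (m / 2)) := fun κ u x z a b =>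
    abs_le_of_biLoc (hin' κ u) hm2.le (mul_exp_neg_le hK₁ hm2.le (l1_nonneg _)) x z a b
  have hterm : ∀ κ : Fin (d + 1),
      BiLoc (wsum (colH K N μ y κ) (fun u => vertexOfK K N (S₂ κ u) ν y')
          - wsum (colH K' N μ y κ) (fun u => vertexOfK K' N (S₂' κ u) ν y')) ((N : ℤ) • y) ((N : ℤ) • y)
        ((εK * ((d + 1 : ℕ) * (C * C₂ * Zl (d + 1) (m / 2))) + C * ((d + 1 : ℕ) * ((εK * C₂ + C * ε₂) * Zl (d + 1) (m / 2))))
          * Zl (d + 1) (m / 2 / 4) * Real.exp (-(m / 2 / 4) * l1 ((N : ℤ) • y - (N : ℤ) • y'))) (m / 2 / 4) := by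
    intro κ
    rw [wsum_sub_wsum_bdd (hw κ) (hw' κ) hm2 (hb κ) (hb' κ)]
    have h1 := biLoc_wsum_self_far (hww κ) (hin κ) hm2 hεK hK₁
    have h2 := biLoc_wsum_self_far (hw' κ) (fun u => hdin κ u) hm2 hC hE₁
    have h := biLoc_add h1 h2
    intro x z a b
    refine (h x z a b).trans (le_of_eq ?_)
    ring
  have hsum := OneStepResolventKernel.biLoc_finset_sum (Finset.univ : Finset (Fin (d + 1))) (fun κ _ => hterm κ)
  simp only [Finset.sum_const, Finset.card_univ, Fintype.card_fin, nsmul_eq_mul] at hsum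
  rw [show m / 2 / 4 = m / 8 by ring] at hsum
  have e : lBi d C C₂ εK ε₂ m * Real.exp (-(m / 8) * l1 ((N : ℤ) • y - (N : ℤ) • y'))
      = (d + 1 : ℕ) * ((εK * ((d + 1 : ℕ) * (C * C₂ * Zl (d + 1) (m / 2)))
          + C * ((d + 1 : ℕ) * ((εK * C₂ + C * ε₂) * Zl (d + 1) (m / 2)))) * Zl (d + 1) (m / 8)
          * Real.exp (-(m / 8) * l1 ((N : ℤ) • y - (N : ℤ) • y'))) := by
    unfold lBi
    ring
  rw [e]
  intro x z a b
  have h := hsum x z a b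
  simpa only [vertex2OfK, vertexOfK, Pi.sub_apply, Finset.sum_sub_distrib] using h

omit [NeZero N] in
/-- [folklore] **THE BI-VERTEX IS LIPSCHITZ IN `(K, S₂)`**: `VertexFamily₂ (vertex2OfK K N S₂ − vertex2OfK K′ N S₂′) N (lBi d C C₂ εK ε₂ m) (m/8)`
(far form, second leg re-centred). -/
theorem vertexFamily₂_vertex2OfK_sub {K K' : MKer (d + 1) (Fib d)} {C εK m : ℝ} (hK : Decays K C m) (hK' : Decays K' C m)
    (hKK : Decays (K - K') εK m) (hm : 0 < m)
    {S₂ S₂' : Fin (d + 1) → (Fin (d + 1) → ℤ) → Fin (d + 1) → (Fin (d + 1) → ℤ) → MKer (d + 1) (Fib d)} {C₂ ε₂ : ℝ}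
    (hS₂ : LocStencil₂ S₂ C₂ m) (hS₂' : LocStencil₂ S₂' C₂ m) (hSS₂ : LocStencil₂ (S₂ - S₂') ε₂ m) :
    VertexFamily₂ (vertex2OfK K N S₂ - vertex2OfK K' N S₂') N (lBi d C C₂ εK ε₂ m) (m / 8) := by
  intro μ y ν y'
  have h := biLoc_vertex2OfK_sub_far (N := N) hK hK' hKK hm hS₂ hS₂' hSS₂ μ y ν y'
  rw [l1_sub_symm] at h
  exact biLoc_recenter_right h (lBi_nonneg (hK.nonneg (Sum.inl 0)) hS₂.nonneg (hKK.nonneg (Sum.inl 0)) hSS₂.nonneg hm)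
    (by positivity) le_rfl

omit [NeZero N] in
/-- [folklore] **THE EXCHANGED BI-VERTEX IS LIPSCHITZ** (index order of `W`): `(μ, y, ν, y′) ↦ (vertex2OfK K N S₂ − vertex2OfK K′ N S₂′) ν y′ μ y` is a
`VertexFamily₂` with constant `lBi`, rate `m/8` (far form, first leg re-centred). -/
theorem vertexFamily₂_vertex2OfK_swap_sub {K K' : MKer (d + 1) (Fib d)} {C εK m : ℝ} (hK : Decays K C m) (hK' : Decays K' C m)
    (hKK : Decays (K - K') εK m) (hm : 0 < m)
    {S₂ S₂' : Fin (d + 1) → (Fin (d + 1) → ℤ) → Fin (d + 1) → (Fin (d + 1) → ℤ) → MKer (d + 1) (Fib d)} {C₂ ε₂ : ℝ}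
    (hS₂ : LocStencil₂ S₂ C₂ m) (hS₂' : LocStencil₂ S₂' C₂ m) (hSS₂ : LocStencil₂ (S₂ - S₂') ε₂ m) :
    VertexFamily₂ (fun μ y ν y' => (vertex2OfK K N S₂ - vertex2OfK K' N S₂') ν y' μ y) N (lBi d C C₂ εK ε₂ m) (m / 8) := by
  intro μ y ν y'
  have h := biLoc_vertex2OfK_sub_far (N := N) hK hK' hKK hm hS₂ hS₂' hSS₂ ν y' μ y
  rw [l1_sub_symm] at h
  exact biLoc_recenter_left h (lBi_nonneg (hK.nonneg (Sum.inl 0)) hS₂.nonneg (hKK.nonneg (Sum.inl 0)) hSS₂.nonneg hm)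
    (by positivity) le_rfl

/-- [folklore] **THE MIXED BI-VERTEX IS LIPSCHITZ IN `(K, M₂)`, FAR FORM**: `mixOfK K N M₂ μ y ν y′ − mixOfK K′ N M₂′ μ y ν y′` is bi-localised at
`(N•y, N•y)` with constant `lBi d C CM₂ εK εM₂ m · e^{−(m/8)|N•y − N•y′|}`, rate `m/8`. -/
theorem biLoc_mixOfK_sub_far {K K' : MKer (d + 1) (Fib d)} {C εK m : ℝ} (hK : Decays K C m) (hK' : Decays K' C m)
    (hKK : Decays (K - K') εK m) (hm : 0 < m)
    {M₂ M₂' : Fin (d + 1) → (Fin (d + 1) → ℤ) → Fin (d + 1) → (Fin (d + 1) → ℤ) → MKer (d + 1) (Fib d)} {C₂ ε₂ : ℝ}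
    (hM₂ : LocStencilFM N M₂ C₂ m) (hM₂' : LocStencilFM N M₂' C₂ m) (hMM₂ : LocStencilFM N (M₂ - M₂') ε₂ m)
    (μ : Fin (d + 1)) (y : Fin (d + 1) → ℤ) (ν : Fin (d + 1)) (y' : Fin (d + 1) → ℤ) :
    BiLoc (mixOfK K N M₂ μ y ν y' - mixOfK K' N M₂' μ y ν y') ((N : ℤ) • y) ((N : ℤ) • y)
      (lBi d C C₂ εK ε₂ m * Real.exp (-(m / 8) * l1 ((N : ℤ) • y - (N : ℤ) • y'))) (m / 8) := by
  have hC : 0 ≤ C := hK.nonneg (Sum.inl 0)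
  have hεK : 0 ≤ εK := hKK.nonneg (Sum.inl 0)
  have hC₂ := hM₂.nonneg
  have hε₂ := hMM₂.nonneg
  have hm2 : 0 < m / 2 := half_pos hm
  have hZ2 := Zl_nonneg (D := d + 1) hm2
  have hK₁ : 0 ≤ (d + 1 : ℕ) * (C * C₂ * Zl (d + 1) (m / 2)) := by positivity
  have hE₁ : 0 ≤ (d + 1 : ℕ) * ((εK * C₂ + C * ε₂) * Zl (d + 1) (m / 2)) := by positivity
  have hin : ∀ (κ : Fin (d + 1)) (u : Fin (d + 1) → ℤ), BiLoc (vertexOfM K N (M₂ κ u) ν y') u u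
      ((d + 1 : ℕ) * (C * C₂ * Zl (d + 1) (m / 2)) * Real.exp (-(m / 2) * l1 (u - (N : ℤ) • y'))) (m / 2) := by
    intro κ u
    have h := biLoc_vertexOfM_slice (N := N) hK hC hM₂ hm κ u ν y'
    rw [← mul_assoc] at h
    exact biLoc_mono h (by positivity) (by linarith)
  have hin' : ∀ (κ : Fin (d + 1)) (u : Fin (d + 1) → ℤ), BiLoc (vertexOfM K' N (M₂' κ u) ν y') u u
      ((d + 1 : ℕ) * (C * C₂ * Zl (d + 1) (m / 2)) * Real.exp (-(m / 2) * l1 (u - (N : ℤ) • y'))) (m / 2) := by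
    intro κ u
    have h := biLoc_vertexOfM_slice (N := N) hK' hC hM₂' hm κ u ν y'
    rw [← mul_assoc] at h
    exact biLoc_mono h (by positivity) (by linarith)
  have hdin : ∀ (κ : Fin (d + 1)) (u : Fin (d + 1) → ℤ), BiLoc (vertexOfM K N (M₂ κ u) ν y' - vertexOfM K' N (M₂' κ u) ν y') u u
      ((d + 1 : ℕ) * ((εK * C₂ + C * ε₂) * Zl (d + 1) (m / 2)) * Real.exp (-(m / 2) * l1 (u - (N : ℤ) • y'))) (m / 2) := by
    intro κ u
    have h := biLoc_vertexOfM_slice_sub (N := N) hK hK' hKK hm hM₂ hM₂' hMM₂ κ u ν y'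
    rw [← mul_assoc] at h
    exact biLoc_mono h (by positivity) (by linarith)
  have hw : ∀ (κ : Fin (d + 1)) (u : Fin (d + 1) → ℤ),
      |colH K N μ y κ u| ≤ C * Real.exp (-(m / 2) * l1 (u - (N : ℤ) • y)) :=
    fun κ u => bound_mono (abs_colH_le (N := N) hK μ y κ u) hC le_rfl (by linarith) (l1_nonneg _)
  have hw' : ∀ (κ : Fin (d + 1)) (u : Fin (d + 1) → ℤ),
      |colH K' N μ y κ u| ≤ C * Real.exp (-(m / 2) * l1 (u - (N : ℤ) • y)) :=
    fun κ u => bound_mono (abs_colH_le (N := N) hK' μ y κ u) hC le_rfl (by linarith) (l1_nonneg _)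
  have hww : ∀ (κ : Fin (d + 1)) (u : Fin (d + 1) → ℤ),
      |(colH K N μ y κ - colH K' N μ y κ) u| ≤ εK * Real.exp (-(m / 2) * l1 (u - (N : ℤ) • y)) := fun κ u => by
    rw [Pi.sub_apply, ← colH_sub]
    exact bound_mono (abs_colH_le (N := N) hKK μ y κ u) hεK le_rfl (by linarith) (l1_nonneg _)
  have hb : ∀ (κ : Fin (d + 1)) (u x z : Fin (d + 1) → ℤ) (a b : Fib d),
      |vertexOfM K N (M₂ κ u) ν y' x z a b| ≤ (d + 1 : ℕ) * (C * C₂ * Zl (d + 1) (m / 2)) := fun κ u x z a b =>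
    abs_le_of_biLoc (hin κ u) hm2.le (mul_exp_neg_le hK₁ hm2.le (l1_nonneg _)) x z a b
  have hb' : ∀ (κ : Fin (d + 1)) (u x z : Fin (d + 1) → ℤ) (a b : Fib d),
      |vertexOfM K' N (M₂' κ u) ν y' x z a b| ≤ (d + 1 : ℕ) * (C * C₂ * Zl (d + 1) (m / 2)) := fun κ u x z a b =>
    abs_le_of_biLoc (hin' κ u) hm2.le (mul_exp_neg_le hK₁ hm2.le (l1_nonneg _)) x z a b
  have hterm : ∀ κ : Fin (d + 1),
      BiLoc (wsum (colH K N μ y κ) (fun u => vertexOfM K N (M₂ κ u) ν y')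
          - wsum (colH K' N μ y κ) (fun u => vertexOfM K' N (M₂' κ u) ν y')) ((N : ℤ) • y) ((N : ℤ) • y)
        ((εK * ((d + 1 : ℕ) * (C * C₂ * Zl (d + 1) (m / 2))) + C * ((d + 1 : ℕ) * ((εK * C₂ + C * ε₂) * Zl (d + 1) (m / 2))))
          * Zl (d + 1) (m / 2 / 4) * Real.exp (-(m / 2 / 4) * l1 ((N : ℤ) • y - (N : ℤ) • y'))) (m / 2 / 4) := by
    intro κ
    rw [wsum_sub_wsum_bdd (hw κ) (hw' κ) hm2 (hb κ) (hb' κ)]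
    have h1 := biLoc_wsum_self_far (hww κ) (hin κ) hm2 hεK hK₁
    have h2 := biLoc_wsum_self_far (hw' κ) (fun u => hdin κ u) hm2 hC hE₁
    have h := biLoc_add h1 h2
    intro x z a b
    refine (h x z a b).trans (le_of_eq ?_)
    ring
  have hsum := OneStepResolventKernel.biLoc_finset_sum (Finset.univ : Finset (Fin (d + 1))) (fun κ _ => hterm κ)
  simp only [Finset.sum_const, Finset.card_univ, Fintype.card_fin, nsmul_eq_mul] at hsum
  rw [show m / 2 / 4 = m / 8 by ring] at hsum
  have e : lBi d C C₂ εK ε₂ m * Real.exp (-(m / 8) * l1 ((N : ℤ) • y - (N : ℤ) • y'))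
      = (d + 1 : ℕ) * ((εK * ((d + 1 : ℕ) * (C * C₂ * Zl (d + 1) (m / 2)))
          + C * ((d + 1 : ℕ) * ((εK * C₂ + C * ε₂) * Zl (d + 1) (m / 2)))) * Zl (d + 1) (m / 8)
          * Real.exp (-(m / 8) * l1 ((N : ℤ) • y - (N : ℤ) • y'))) := by
    unfold lBi
    ring
  rw [e]
  intro x z a b
  have h := hsum x z a b
  simpa only [mixOfK, vertexOfK, Pi.sub_apply, Finset.sum_sub_distrib] using h

/-- [folklore] **THE MIXED BI-VERTEX IS LIPSCHITZ IN `(K, M₂)`** (field column at the first bond): constant `lBi d C CM₂ εK εM₂ m`, rate `m/8`. -/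
theorem vertexFamily₂_mixOfK_sub {K K' : MKer (d + 1) (Fib d)} {C εK m : ℝ} (hK : Decays K C m) (hK' : Decays K' C m)
    (hKK : Decays (K - K') εK m) (hm : 0 < m)
    {M₂ M₂' : Fin (d + 1) → (Fin (d + 1) → ℤ) → Fin (d + 1) → (Fin (d + 1) → ℤ) → MKer (d + 1) (Fib d)} {C₂ ε₂ : ℝ}
    (hM₂ : LocStencilFM N M₂ C₂ m) (hM₂' : LocStencilFM N M₂' C₂ m) (hMM₂ : LocStencilFM N (M₂ - M₂') ε₂ m) :
    VertexFamily₂ (mixOfK K N M₂ - mixOfK K' N M₂') N (lBi d C C₂ εK ε₂ m) (m / 8) := by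
  intro μ y ν y'
  have h := biLoc_mixOfK_sub_far hK hK' hKK hm hM₂ hM₂' hMM₂ μ y ν y'
  rw [l1_sub_symm] at h
  exact biLoc_recenter_right h (lBi_nonneg (hK.nonneg (Sum.inl 0)) hM₂.nonneg (hKK.nonneg (Sum.inl 0)) hMM₂.nonneg hm)
    (by positivity) le_rfl

/-- [folklore] **THE EXCHANGED MIXED BI-VERTEX IS LIPSCHITZ** (index order of `W`): `(μ, y, ν, y′) ↦ (mixOfK K N M₂ − mixOfK K′ N M₂′) ν y′ μ y`,
constant `lBi`, rate `m/8`. -/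
theorem vertexFamily₂_mixOfK_swap_sub {K K' : MKer (d + 1) (Fib d)} {C εK m : ℝ} (hK : Decays K C m) (hK' : Decays K' C m)
    (hKK : Decays (K - K') εK m) (hm : 0 < m)
    {M₂ M₂' : Fin (d + 1) → (Fin (d + 1) → ℤ) → Fin (d + 1) → (Fin (d + 1) → ℤ) → MKer (d + 1) (Fib d)} {C₂ ε₂ : ℝ}
    (hM₂ : LocStencilFM N M₂ C₂ m) (hM₂' : LocStencilFM N M₂' C₂ m) (hMM₂ : LocStencilFM N (M₂ - M₂') ε₂ m) :
    VertexFamily₂ (fun μ y ν y' => (mixOfK K N M₂ - mixOfK K' N M₂') ν y' μ y) N (lBi d C C₂ εK ε₂ m) (m / 8) := by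
  intro μ y ν y'
  have h := biLoc_mixOfK_sub_far hK hK' hKK hm hM₂ hM₂' hMM₂ ν y' μ y
  rw [l1_sub_symm] at h
  exact biLoc_recenter_left h (lBi_nonneg (hK.nonneg (Sum.inl 0)) hM₂.nonneg (hKK.nonneg (Sum.inl 0)) hMM₂.nonneg hm)
    (by positivity) le_rfl

end BiVertex

end Summit.QuantumFields.BalabanUV.Beta.GAN24.SecondOrderLipschitzBi

end
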